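import Summits.QuantumFields.YangMills.Theorems.UnitScaleTiltProp7TorusScaleCutoff
import HarnessLib

/-!
# Route `UnitScaleTilt`, crux «MinimiserStabilityRegPr» (stmt-QuantumFields-19200), E′ ∕ (N06) LANE II «DIVERGENCE RECOVERY AT CURVED `W`» — brick (B6-a), part 1 of 2:
# CYCLIC SMOOTHSTEP HATS ON `ZMod (A·M)` — the one-dimensional partition of unity at spacing `M` behind the scale-`R` p.o.u. of the member torus

Cell `ym3-torus`, width seat `ym3-torus-px11` (gen 6); ★★OWNER RULING №23 (c) + ★p1 g19 LANE II NAMER WORD №1 «(B6) → px11 g6»; LOCATE-B6-POU-px11g6 (fcd9ef01) §1 (P1).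
THEOREMS ONLY (0 `def`, 0 `sorry`); `--supports stmt-QuantumFields-19200`, count-neutral.  YM₃ on T³ is a ladder rung (R3), not the Clay problem; nothing here claims (B6),
(V3), `hN06`, a stub, the crux, d = 4 or the mass gap.

THE OBJECT.  On the cycle `ZMod N`, `N = A·M` (`A ≥ 2` centres at spacing `M ≥ 1`), the HAT at the centre `c`: `θ_c(t) = S(dist(t,c)∕M)` with the cyclic distance
`dist(t,c) = min (t−c).val (c−t).val` and the CLAMPED CUBIC SMOOTHSTEP `S(u) = p(clamp u)`, `p(v) = 1 − 3v² + 2v³`, `clamp u = max 0 (min u 1)` of ✓ `Prop7TorusAgmonWeight`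
(`abs_smoothstep_sub_le`: `p` is `3∕2`-Lipschitz on `[0,1]`; `abs_smoothstep_taylor_le`: `S` is `C^{1,1}`, `|S(u+η) − S(u) − S′(u)η| ≤ 3η²`, `S′(u) = −6·clamp u·(1 − clamp u)`).
Everything is written out (no definition): the hat value at distance `d` is `1 − 3·(max 0 (min (d∕M) 1))² + 2·(max 0 (min (d∕M) 1))³`.
* §1 the hat as a function of the distance: values in `[0,1]`, `= 0` for `d ≥ M`, `θ(r) + θ(M−r) = 1` (`p(v) + p(1−v) = 1`), `|θ(d′) − θ(d)| ≤ (3∕2)∕M` for `|d′−d| ≤ 1`, and the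
  SECOND DIFFERENCE `|θ(dp) + θ(dm) − 2θ(d)| ≤ 6∕M²` whenever `|d± − d| ≤ 1` and (`dp + dm = 2d` or `d = 0` or `d ≥ M`) — the two exceptional cases are exactly where `S′ = 0`, so the
  `C^{1,1}` Taylor letter applies twice with NO first-order remainder (the kink of `dist` at the centre and the plateau beyond `M` cost nothing).
* §2 the cyclic distance under `t ↦ t ± 1`: `dist = min k (N − k)`, `k = (t−c).val`; one step moves `dist` by at most `1`, and by exactly `±1` with opposite signs off the centre and
  the antipodal pair (`0 < dist`, `2·dist + 2 ≤ N`).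
* §3 ★ the STRUCTURE of the centres `c_a = a·M`, `a < A`: with `t.val = qM + r` (`r < M`): `dist(t, c_q) = r`, `dist(t, c_{(q+1) mod A}) = M − r`, and `dist(t, c_a) ≥ M` for every other `a`.
(The consequences — `Σ_{a<A} θ_{c_a} = 1`, at most two hats alive, the rows of `t ↦ θ_c(t)` — are the sibling file `…Lane2CyclicHatFamily`.)
HONEST SCOPE.  One-dimensional lattice bookkeeping + the tree's smoothstep algebra; the product family on `Site (F.P K) 0` and the commutator rows are the sibling files.

References: T. Bałaban, CMP 96 (1984) 223–250 [Balaban1984PropagatorsII] ((1.9) p.226: smooth cutoffs at a lattice scale); CMP 99 (1985) 389–434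
[Balaban1985BackgroundPropagators] ((3.23) p.394: the localisation these hats serve).
-/

set_option autoImplicit false

noncomputable section

open scoped BigOperators

namespace Summit.QuantumFields.YangMills.Theorems.Prop7Lane2CyclicHats

open Summit.QuantumFields.YangMills.Theorems.Prop7TorusAgmonWeight (clamp_mem abs_clamp_sub_clamp_le smoothstep_mem abs_smoothstep_sub_le abs_smoothstep_taylor_le)
open Finset

/-! ## §1 The hat as a function of the distance `d` (real algebra) -/

section Hat

variable {M : ℕ} (hM : 1 ≤ M)
include hM

omit hM in
/-- `0 ≤ θ(d) ≤ 1`. [folklore] -/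
theorem hat_mem (d : ℕ) :
    0 ≤ 1 - 3 * (max 0 (min ((d : ℝ) / M) 1)) ^ 2 + 2 * (max 0 (min ((d : ℝ) / M) 1)) ^ 3 ∧
      1 - 3 * (max 0 (min ((d : ℝ) / M) 1)) ^ 2 + 2 * (max 0 (min ((d : ℝ) / M) 1)) ^ 3 ≤ 1 :=
  smoothstep_mem (clamp_mem _).1 (clamp_mem _).2

/-- Beyond the spacing the hat vanishes: `d ≥ M → θ(d) = 0`. [folklore] -/
theorem hat_eq_zero_of_le {d : ℕ} (hd : M ≤ d) :
    1 - 3 * (max 0 (min ((d : ℝ) / M) 1)) ^ 2 + 2 * (max 0 (min ((d : ℝ) / M) 1)) ^ 3 = 0 := by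
  have hM0 : (0 : ℝ) < M := by exact_mod_cast hM
  have h1 : (1 : ℝ) ≤ (d : ℝ) / M := by rw [le_div_iff₀ hM0, one_mul]; exact_mod_cast hd
  rw [min_eq_right h1, max_eq_right zero_le_one]; norm_num

/-- A non-zero hat value forces `d < M`. [folklore] -/
theorem lt_of_hat_ne_zero {d : ℕ} (h : 1 - 3 * (max 0 (min ((d : ℝ) / M) 1)) ^ 2 + 2 * (max 0 (min ((d : ℝ) / M) 1)) ^ 3 ≠ 0) : d < M := by
  by_contra hd
  exact h (hat_eq_zero_of_le hM (not_lt.mp hd))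

/-- For `d ≤ M` the clamp is inactive: `clamp(d∕M) = d∕M`. [folklore] -/
theorem clamp_eq_of_le {d : ℕ} (hd : d ≤ M) : max 0 (min ((d : ℝ) / M) 1) = (d : ℝ) / M := by
  have hM0 : (0 : ℝ) < M := by exact_mod_cast hM
  have h1 : (d : ℝ) / M ≤ 1 := by rw [div_le_one hM0]; exact_mod_cast hd
  rw [min_eq_left h1, max_eq_right (by positivity)]

/-- **THE TWO NEIGHBOURING HATS TILE**: `θ(r) + θ(M − r) = 1` for `r ≤ M` (`p(v) + p(1−v) = 1`). [folklore] -/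
theorem hat_add_hat_sub_eq_one {r : ℕ} (hr : r ≤ M) :
    (1 - 3 * (max 0 (min ((r : ℝ) / M) 1)) ^ 2 + 2 * (max 0 (min ((r : ℝ) / M) 1)) ^ 3)
      + (1 - 3 * (max 0 (min (((M - r : ℕ) : ℝ) / M) 1)) ^ 2 + 2 * (max 0 (min (((M - r : ℕ) : ℝ) / M) 1)) ^ 3) = 1 := by
  have hM0 : (0 : ℝ) < M := by exact_mod_cast hM
  rw [clamp_eq_of_le hM hr, clamp_eq_of_le hM (Nat.sub_le M r), Nat.cast_sub hr]
  have : ((M : ℝ) - r) / M = 1 - (r : ℝ) / M := by field_simp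
  rw [this]; ring

/-- **STEP ROW**: `|θ(d′) − θ(d)| ≤ (3∕2)∕M` whenever `|d′ − d| ≤ 1`. [folklore] -/
theorem abs_hat_sub_hat_le {d d' : ℕ} (h1 : d' ≤ d + 1) (h2 : d ≤ d' + 1) :
    |(1 - 3 * (max 0 (min ((d' : ℝ) / M) 1)) ^ 2 + 2 * (max 0 (min ((d' : ℝ) / M) 1)) ^ 3)
        - (1 - 3 * (max 0 (min ((d : ℝ) / M) 1)) ^ 2 + 2 * (max 0 (min ((d : ℝ) / M) 1)) ^ 3)| ≤ 3 / 2 / (M : ℝ) := by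
  have hM0 : (0 : ℝ) < M := by exact_mod_cast hM
  have ha := clamp_mem ((d' : ℝ) / M)
  have hb := clamp_mem ((d : ℝ) / M)
  refine (abs_smoothstep_sub_le ha.1 ha.2 hb.1 hb.2).trans ?_
  have hc := abs_clamp_sub_clamp_le ((d' : ℝ) / M) ((d : ℝ) / M)
  have hdiff : |(d' : ℝ) / M - (d : ℝ) / M| ≤ 1 / M := by
    rw [← sub_div, abs_div, abs_of_pos hM0, div_le_div_iff_of_pos_right hM0, abs_le]
    constructor
    · have : (d : ℝ) ≤ d' + 1 := by exact_mod_cast h2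
      linarith
    · have : (d' : ℝ) ≤ d + 1 := by exact_mod_cast h1
      linarith
  calc 3 / 2 * |max 0 (min ((d' : ℝ) / M) 1) - max 0 (min ((d : ℝ) / M) 1)| ≤ 3 / 2 * (1 / M) :=
        mul_le_mul_of_nonneg_left (hc.trans hdiff) (by norm_num)
    _ = 3 / 2 / (M : ℝ) := by ring

/-- **SECOND-DIFFERENCE ROW**: `|θ(dp) + θ(dm) − 2θ(d)| ≤ 6∕M²` whenever both neighbours are within `1` of `d` and either `dp + dm = 2d` (the generic site) or `d = 0` (the centre:
`S′(0) = 0`) or `d ≥ M` (the plateau: `S′ = 0`) — two applications of the `C^{1,1}` Taylor letter, the first-order terms cancelling or vanishing. [folklore] -/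
theorem abs_hat_second_diff_le {d dp dm : ℕ} (hp1 : dp ≤ d + 1) (hp2 : d ≤ dp + 1) (hm1 : dm ≤ d + 1) (hm2 : d ≤ dm + 1)
    (hcase : dp + dm = 2 * d ∨ d = 0 ∨ M ≤ d) :
    |(1 - 3 * (max 0 (min ((dp : ℝ) / M) 1)) ^ 2 + 2 * (max 0 (min ((dp : ℝ) / M) 1)) ^ 3)
        + (1 - 3 * (max 0 (min ((dm : ℝ) / M) 1)) ^ 2 + 2 * (max 0 (min ((dm : ℝ) / M) 1)) ^ 3)
        - 2 * (1 - 3 * (max 0 (min ((d : ℝ) / M) 1)) ^ 2 + 2 * (max 0 (min ((d : ℝ) / M) 1)) ^ 3)| ≤ 6 / (M : ℝ) ^ 2 := by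
  have hM0 : (0 : ℝ) < M := by exact_mod_cast hM
  set u : ℝ := (d : ℝ) / M with hu
  set ηp : ℝ := ((dp : ℝ) - d) / M with hηp
  set ηm : ℝ := ((dm : ℝ) - d) / M with hηm
  have hup : (dp : ℝ) / M = u + ηp := by rw [hu, hηp]; ring
  have hum : (dm : ℝ) / M = u + ηm := by rw [hu, hηm]; ring
  -- the two Taylor letters
  have hTp := abs_smoothstep_taylor_le u ηp
  have hTm := abs_smoothstep_taylor_le u ηm
  -- `|η±| ≤ 1∕M`
  have hηp1 : ηp ^ 2 ≤ 1 / (M : ℝ) ^ 2 := by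
    have : |ηp| ≤ 1 / M := by
      rw [hηp, abs_div, abs_of_pos hM0, div_le_div_iff_of_pos_right hM0, abs_le]
      constructor
      · have : (d : ℝ) ≤ dp + 1 := by exact_mod_cast hp2
        linarith
      · have : (dp : ℝ) ≤ d + 1 := by exact_mod_cast hp1
        linarith
    have h0 : 0 ≤ |ηp| := abs_nonneg _
    calc ηp ^ 2 = |ηp| ^ 2 := (sq_abs _).symm
      _ ≤ (1 / M) ^ 2 := pow_le_pow_left₀ h0 this 2
      _ = 1 / (M : ℝ) ^ 2 := by ring
  have hηm1 : ηm ^ 2 ≤ 1 / (M : ℝ) ^ 2 := by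
    have : |ηm| ≤ 1 / M := by
      rw [hηm, abs_div, abs_of_pos hM0, div_le_div_iff_of_pos_right hM0, abs_le]
      constructor
      · have : (d : ℝ) ≤ dm + 1 := by exact_mod_cast hm2
        linarith
      · have : (dm : ℝ) ≤ d + 1 := by exact_mod_cast hm1
        linarith
    have h0 : 0 ≤ |ηm| := abs_nonneg _
    calc ηm ^ 2 = |ηm| ^ 2 := (sq_abs _).symm
      _ ≤ (1 / M) ^ 2 := pow_le_pow_left₀ h0 this 2
      _ = 1 / (M : ℝ) ^ 2 := by ring
  -- the first-order terms cancel or vanish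
  have hfirst : (-6 * max 0 (min u 1) * (1 - max 0 (min u 1))) * ηp + (-6 * max 0 (min u 1) * (1 - max 0 (min u 1))) * ηm = 0 := by
    rcases hcase with hsum | h0 | hbig
    · have : ηp + ηm = 0 := by
        rw [hηp, hηm, ← add_div]
        have : (dp : ℝ) + dm = 2 * d := by exact_mod_cast hsum
        have : (dp : ℝ) - d + ((dm : ℝ) - d) = 0 := by linarith
        rw [this, zero_div]
      calc _ = (-6 * max 0 (min u 1) * (1 - max 0 (min u 1))) * (ηp + ηm) := by ring
        _ = 0 := by rw [this, mul_zero]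
    · have hu0 : u = 0 := by rw [hu, h0, Nat.cast_zero, zero_div]
      rw [hu0, min_eq_left (zero_le_one : (0:ℝ) ≤ 1), max_self]; ring
    · have hu1 : max 0 (min u 1) = 1 := by
        have : (1 : ℝ) ≤ u := by rw [hu, le_div_iff₀ hM0, one_mul]; exact_mod_cast hbig
        rw [min_eq_right this, max_eq_right zero_le_one]
      rw [hu1]; ring
  -- assemble
  rw [hup, hum]
  have key : (1 - 3 * max 0 (min (u + ηp) 1) ^ 2 + 2 * max 0 (min (u + ηp) 1) ^ 3)
      + (1 - 3 * max 0 (min (u + ηm) 1) ^ 2 + 2 * max 0 (min (u + ηm) 1) ^ 3)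
      - 2 * (1 - 3 * max 0 (min u 1) ^ 2 + 2 * max 0 (min u 1) ^ 3)
      = ((1 - 3 * max 0 (min (u + ηp) 1) ^ 2 + 2 * max 0 (min (u + ηp) 1) ^ 3) - (1 - 3 * max 0 (min u 1) ^ 2 + 2 * max 0 (min u 1) ^ 3)
          - (-6 * max 0 (min u 1) * (1 - max 0 (min u 1))) * ηp)
        + ((1 - 3 * max 0 (min (u + ηm) 1) ^ 2 + 2 * max 0 (min (u + ηm) 1) ^ 3) - (1 - 3 * max 0 (min u 1) ^ 2 + 2 * max 0 (min u 1) ^ 3)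
          - (-6 * max 0 (min u 1) * (1 - max 0 (min u 1))) * ηm)
        + ((-6 * max 0 (min u 1) * (1 - max 0 (min u 1))) * ηp + (-6 * max 0 (min u 1) * (1 - max 0 (min u 1))) * ηm) := by ring
  rw [key, hfirst, add_zero]
  refine (abs_add_le _ _).trans ?_
  calc |_| + |_| ≤ 3 * ηp ^ 2 + 3 * ηm ^ 2 := add_le_add hTp hTm
    _ ≤ 3 * (1 / (M : ℝ) ^ 2) + 3 * (1 / (M : ℝ) ^ 2) := by gcongr
    _ = 6 / (M : ℝ) ^ 2 := by ring

end Hat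

/-! ## §2 The cyclic distance `min (t−c).val (c−t).val` under one lattice step -/

section Dist

variable {N : ℕ} [NeZero N]

/-- `dist(t,c) = min k (N − k)` with `k = (t − c).val`. [folklore] -/
theorem dist_eq_min_val (t c : ZMod N) : min (t - c).val (c - t).val = min (t - c).val (N - (t - c).val) := by
  rw [show c - t = -(t - c) by ring, ZMod.neg_val]
  split_ifs with h
  · rw [h, ZMod.val_zero]; simp
  · rfl

omit [NeZero N] in
/-- `dist` is symmetric. [folklore] -/
theorem dist_comm (t c : ZMod N) : min (t - c).val (c - t).val = min (c - t).val (t - c).val := min_comm _ _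

/-- `2·dist ≤ N`. [folklore] -/
theorem two_mul_dist_le (t c : ZMod N) : 2 * min (t - c).val (c - t).val ≤ N := by
  rw [dist_eq_min_val]
  have := ZMod.val_lt (t - c)
  rcases le_total (t - c).val (N - (t - c).val) with h | h
  · rw [min_eq_left h]; omega
  · rw [min_eq_right h]; omega

variable (hN : 1 < N)
include hN

/-- One step forward: `((t+1) − c).val` is `k + 1` (no wrap) or `0` (wrap, `k + 1 = N`). [folklore] -/
theorem val_add_one_sub (t c : ZMod N) :
    ((t + 1 - c).val = (t - c).val + 1 ∧ (t - c).val + 1 < N) ∨ ((t + 1 - c).val = 0 ∧ (t - c).val + 1 = N) := by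
  haveI : Fact (1 < N) := ⟨hN⟩
  have hk := ZMod.val_lt (t - c)
  have e : t + 1 - c = (t - c) + 1 := by ring
  rw [e, ZMod.val_add, ZMod.val_one]
  rcases Nat.lt_or_ge ((t - c).val + 1) N with h | h
  · left; exact ⟨Nat.mod_eq_of_lt h, h⟩
  · right
    have hE : (t - c).val + 1 = N := le_antisymm hk h
    exact ⟨by rw [hE, Nat.mod_self], hE⟩

/-- One step backward: `((t−1) − c).val` is `k − 1` (`k ≥ 1`) or `N − 1` (`k = 0`). [folklore] -/
theorem val_sub_one_sub (t c : ZMod N) :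
    ((t - 1 - c).val + 1 = (t - c).val) ∨ ((t - 1 - c).val = N - 1 ∧ (t - c).val = 0) := by
  have h := val_add_one_sub hN (t - 1) c
  have e : t - 1 + 1 - c = t - c := by ring
  rw [e] at h
  rcases h with ⟨h1, _⟩ | ⟨h1, h2⟩
  · left; omega
  · right; exact ⟨by omega, h1⟩

/-- **LIPSCHITZ**: one lattice step changes the cyclic distance by at most `1`. [folklore] -/
theorem dist_add_one_le (t c : ZMod N) :
    min (t + 1 - c).val (c - (t + 1)).val ≤ min (t - c).val (c - t).val + 1 ∧
      min (t - c).val (c - t).val ≤ min (t + 1 - c).val (c - (t + 1)).val + 1 := by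
  rw [dist_eq_min_val, dist_eq_min_val]
  have hk := ZMod.val_lt (t - c)
  rcases val_add_one_sub hN t c with ⟨h1, h2⟩ | ⟨h1, h2⟩
  · rw [h1]; constructor <;> · simp only [Nat.min_def]; split_ifs <;> omega
  · rw [h1]; constructor <;> · simp only [Nat.min_def]; split_ifs <;> omega

/-- The same for the backward step. [folklore] -/
theorem dist_sub_one_le (t c : ZMod N) :
    min (t - 1 - c).val (c - (t - 1)).val ≤ min (t - c).val (c - t).val + 1 ∧
      min (t - c).val (c - t).val ≤ min (t - 1 - c).val (c - (t - 1)).val + 1 := by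
  have h := dist_add_one_le hN (t - 1) c
  rw [sub_add_cancel] at h
  exact ⟨h.2, h.1⟩

/-- **EXACT STEPS OFF THE CENTRE AND THE ANTIPODAL PAIR**: if `0 < dist(t,c)` and `2·dist(t,c) + 2 ≤ N`, the two neighbours' distances add up to `2·dist(t,c)` (one is `dist + 1`,
the other `dist − 1`). [folklore] -/
theorem dist_add_one_add_dist_sub_one (t c : ZMod N) (h0 : 0 < min (t - c).val (c - t).val) (h2 : 2 * min (t - c).val (c - t).val + 2 ≤ N) :
    min (t + 1 - c).val (c - (t + 1)).val + min (t - 1 - c).val (c - (t - 1)).val = 2 * min (t - c).val (c - t).val := by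
  rw [dist_eq_min_val, dist_eq_min_val, dist_eq_min_val] at *
  have hk := ZMod.val_lt (t - c)
  have hk1 := ZMod.val_lt (t - 1 - c)
  rcases val_add_one_sub hN t c with ⟨hp1, hp2⟩ | ⟨hp1, hp2⟩ <;>
    rcases val_sub_one_sub hN t c with hm1 | ⟨hm1, hm2⟩ <;>
    · rw [hp1]; simp only [Nat.min_def] at *; split_ifs at * <;> omega

end Dist

/-! ## §3 ★ The structure of the centres `c_a = a·M` on `ZMod (A·M)` -/

section Centres

variable {N A M : ℕ} [NeZero N] (hN : N = A * M) (hA : 2 ≤ A) (hM : 1 ≤ M)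
include hN hA hM

omit hA in
/-- `(t − a·M).val` in terms of `t.val`. [folklore] -/
theorem val_sub_centre (t : ZMod N) {a : ℕ} (ha : a < A) :
    (t - ((a * M : ℕ) : ZMod N)).val = if a * M ≤ t.val then t.val - a * M else t.val + N - a * M := by
  have haM : a * M < N := by rw [hN]; exact Nat.mul_lt_mul_of_pos_right ha (by omega)
  have hcv : (((a * M : ℕ) : ZMod N)).val = a * M := ZMod.val_cast_of_lt haM
  have hv := ZMod.val_lt t
  split_ifs with h
  · rw [ZMod.val_sub (by rw [hcv]; exact h), hcv]
  · rw [sub_eq_add_neg, ZMod.val_add, ZMod.neg_val]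
    split_ifs with h0
    · exfalso
      have : a * M = 0 := by rw [← hcv, h0, ZMod.val_zero]
      omega
    · rw [hcv, Nat.mod_eq_of_lt (by omega)]; omega

/-- ★ **STRUCTURE LEMMA**: with `q = t.val ∕ M`, `r = t.val mod M`: the distance to `c_q` is `r`, to `c_{(q+1) mod A}` is `M − r`, and to every other centre at least `M`. [folklore] -/
theorem dist_centres (t : ZMod N) :
    min (t - ((t.val / M * M : ℕ) : ZMod N)).val ((((t.val / M * M : ℕ) : ZMod N)) - t).val = t.val % M ∧
    min (t - (((t.val / M + 1) % A * M : ℕ) : ZMod N)).val (((((t.val / M + 1) % A * M : ℕ) : ZMod N)) - t).val = M - t.val % M ∧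
    ∀ a : ℕ, a < A → a ≠ t.val / M → a ≠ (t.val / M + 1) % A →
      M ≤ min (t - ((a * M : ℕ) : ZMod N)).val ((((a * M : ℕ) : ZMod N)) - t).val := by
  have hv := ZMod.val_lt t
  have hM0 : 0 < M := by omega
  set q := t.val / M with hq
  set r := t.val % M with hr
  have hdecomp : t.val = q * M + r := by rw [hq, hr, mul_comm]; exact (Nat.div_add_mod _ _).symm
  have hrM : r < M := Nat.mod_lt _ hM0
  have hqA : q < A := by
    by_contra h
    have : A * M ≤ q * M := Nat.mul_le_mul_right M (not_lt.mp h)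
    omega
  refine ⟨?_, ?_, ?_⟩
  · have h2M : 2 * M ≤ N := by rw [hN]; exact Nat.mul_le_mul_right M hA
    rw [dist_eq_min_val, val_sub_centre hN hM t hqA, if_pos (by omega)]
    simp only [Nat.min_def]; split_ifs <;> omega
  · rw [dist_eq_min_val]
    have h2M : 2 * M ≤ N := by rw [hN]; exact Nat.mul_le_mul_right M hA
    rcases Nat.lt_or_ge (q + 1) A with hq1 | hq1
    · have e1 : (q + 1) * M = q * M + M := by ring
      have hq1M : (q + 1) * M + M ≤ N := by rw [hN, ← Nat.succ_mul]; exact Nat.mul_le_mul_right M hq1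
      rw [Nat.mod_eq_of_lt hq1, val_sub_centre hN hM t hq1]
      have hnot : ¬ ((q + 1) * M ≤ t.val) := by omega
      rw [if_neg hnot]
      simp only [Nat.min_def]; split_ifs <;> omega
    · have hqe : q + 1 = A := le_antisymm hqA hq1
      have hN' : N = q * M + M := by rw [hN, ← hqe]; ring
      have hA' : 1 ≤ q := by omega
      have hMq : M ≤ q * M := Nat.le_mul_of_pos_left M hA'
      rw [hqe, Nat.mod_self, val_sub_centre hN hM t (by omega)]
      rw [if_pos (by omega)]
      simp only [Nat.min_def]; split_ifs <;> omega
  · intro a ha hne1 hne2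
    rw [dist_eq_min_val, val_sub_centre hN hM t ha]
    have hAM : a * M + M ≤ N := by rw [hN, ← Nat.succ_mul]; exact Nat.mul_le_mul_right M ha
    have hqM : q * M + M ≤ N := by rw [hN, ← Nat.succ_mul]; exact Nat.mul_le_mul_right M hqA
    have h2M : 2 * M ≤ N := by rw [hN]; exact Nat.mul_le_mul_right M hA
    rcases Nat.lt_or_gt_of_ne hne1 with hlt | hgt
    · -- `a < q`: no wrap unless `a = 0`, `q = A − 1`, which `hne2` excludes
      have h1 : a * M + M ≤ q * M := by rw [← Nat.succ_mul]; exact Nat.mul_le_mul_right M hlt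
      rw [if_pos (by omega)]
      have h2 : M ≤ a * M ∨ q * M + M + M ≤ N := by
        rcases Nat.eq_zero_or_pos a with ha0 | ha0
        · right
          have hq1 : q + 1 < A := by
            rcases Nat.lt_or_ge (q + 1) A with h4 | h4
            · exact h4
            · exfalso
              have hqe : q + 1 = A := le_antisymm hqA h4
              rw [hqe, Nat.mod_self] at hne2
              exact hne2 ha0
          have h5 : (q + 2) * M ≤ A * M := Nat.mul_le_mul_right M hq1
          have e : (q + 2) * M = q * M + M + M := by ring
          rw [hN]; omega
        · left; exact Nat.le_mul_of_pos_left M ha0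
      simp only [Nat.min_def]; split_ifs <;> omega
    · -- `a > q`, and `a ≠ q + 1`
      have hne2' : a ≠ q + 1 := by
        intro h
        rcases Nat.lt_or_ge (q + 1) A with h4 | h4
        · rw [Nat.mod_eq_of_lt h4] at hne2; exact hne2 h
        · omega
      have hge : q + 2 ≤ a := by omega
      have h1 : q * M + M + M ≤ a * M := by
        have h5 : (q + 2) * M ≤ a * M := Nat.mul_le_mul_right M hge
        have e : (q + 2) * M = q * M + M + M := by ring
        omega
      rw [if_neg (by omega)]
      simp only [Nat.min_def]; split_ifs <;> omega

end Centres

end Summit.QuantumFields.YangMills.Theorems.Prop7Lane2CyclicHats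

end
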